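import Mathlib
import HarnessLib
import HarnessLib.Audit
import Summits.ResolutionOfSingularities.Statement
import HarnessLib.Audit.Status.Attr

/-!
Route: SyzygyFlattening

DORMANT since 2026-08-26T09:02:42Z (reconciler: no traction for 8.4 d (last activity item-evidence-added at 2026-08-17T22:44:56Z); parked, not closed — `ledger route dormant route-ResolutionOfSingularities-SyzygyFlattening --off` to rea) — unstaffed, not closed; items shared with open routes are served there. `ledger route dormant <id> --off` reactivates.

# Route SyzygyFlattening — flatten the top syzygy of the singular locus — Koszul cofactors replace
derivatives; McKay curve extraction is the engine; globalise by canonicity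

BARRIER-INVERSION route (operator C, fourth reading of the catalogue: the DERIVATIVE clause). Assume
the catalogue. Kollár 3.74.6 / KangarooShadeIncrease: "a lack of good replacement for higher
derivatives"; NarasimhanMaximalContact + Cossart 2011 (Giraud's W_x "is in general not regular … in
the purely inseparable case W_x = Z: the theory is empty"); ResidualOrderUnbounded (point centres
pump the residual order, larger centres escape); DirectrixSmallCharacteristic; InseparableBaseChange
×3 and FrobeniusTwistResolution (regularity is absolute); LocalMonomializationFails /
ArtinSchreierPuiseux (no parametrisation, no map-monomialisation); DimensionFourFrontier (no
patching); QuasiExcellenceNecessary (the line must fail on Nagata's ring). Then a successful line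
must (C1) choose centres by a datum that is derivative-free and invariant under the cleaning gauge z
↦ z + h, (C2) allow singular, non-reduced centres of every dimension, (C3) be absolute over every
field, (C4) consume finite generation at a named step, (C5) globalise by canonicity, (C6)
parametrise nothing. The one classical identity that survives where every derivative dies is
DIVISION: f ∈ 𝔪 ⇒ f = Σ xᵢgᵢ. Its gauge-invariant avatar is the syzygy MODULE of the residue field
(over a hypersurface: the Koszul matrix factorisation of f, Eisenbud1980), and the canonical way to
let a module choose a centre is to FLATTEN it (Raynaud–Gruson; Nash transform of a module,
OnetoZatini1991, Villamayor2006Flattening). It suffices to show X = R1 ∧ HR ∧ G for the operator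
Φ(X) := normalised blow-up of the determinant (Plücker) ideal N ≅ ∧^rk M / torsion of M :=
Ω^n(O_Sing X) (n = dim X, Sing X = non-regular locus, reduced; Ω^n = n-th syzygy sheaf, well defined
up to free summands, so N is well defined up to an invertible twist), iterated; regular schemes are
exactly its fixed points (Auslander–Buchsbaum–Serre + Dutta1989; item NoStall). Followed along a
valuation v with centre c the tower is T₀ = A_c, T_(m+1) = (normalisation of T_m[N_m/x])_c with N_m
= N(Ω^n_(T_m)(T_m/J_m)), J_m the radical of the non-regular locus, v(x) minimal — typed verbatim
(let-bound loc / chart / nrm / tower over Mathlib's Subalgebra, ValuationSubring, LinearMap.range,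
Matrix.det, Algebra.trdeg, IsRegularLocalRing). R1 = RankOneTermination (rank 2): along every
RANK-ONE valuation of DIMENSION ZERO (Krull dim O = 1, residue field algebraic over k), over EVERY
field k of char p, the tower reaches a regular local ring (change of ground field k ↦ k(t) ⊂ O_v
makes this cover all rank-one valuations). HR = HigherRankTermination (rank 3): R1 for all ground
fields ⇒ termination along every dimension-zero valuation. G = Globalisation (rank 4):
dimension-zero valuative termination ⇒ ResolutionInChar p, because dimension-zero valuations suffice
(compose v with a dimension-zero valuation of its residue field — also filed separately as the free
support DimZeroSuffices) and Φ is a Zariski-local operator on X (the v-towers are the local rings of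
ONE projective tower X_m → X), Reg X_m is open (excellence) and the Riemann–Zariski space is
quasi-compact. No Descent item: every statement is over an arbitrary field. No card is realised;
nearest cards: homological-conductor-ca-blowup (routed: HomologicalConductor — an annihilator
IDEAL), kunz-frobenius-flattening-tower (flattens F_*O — stalls off the F-pure world,
HaraSawadaYasuda2011), lambda-prime-reduced-top-locus (= the index-ONE truncation N(Ω¹(O_Sing)) =
I_Sing of this tower).
Lean: `RankOneTermination ∧ HigherRankTermination ∧ Globalisation`

## Assembly
Pure logic, certified sorry-free (Sketch.lean / glue.lean: lean check rc 0, 0 sorries; gate verdict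
closes OK, axioms propext · Classical.choice · Quot.sound): at a prime p, HigherRankTermination p
applied to RankOneTermination p gives termination along all dimension-zero valuations — verbatim the
antecedent of Globalisation p (rev 1), which returns ResolutionInChar p; the summit is ∀ p prime,
ResolutionInChar p by Iff.rfl. `closes h1 h2 hG := fun p hp => hG p hp (h2 p hp (h1 p hp))` uses
every crux and nothing else; DimZeroSuffices (the free reduction from all valuations to
dimension-zero ones, absorbed into Globalisation's content), NoStall and SurfaceTermination sit
outside the deciding chain as calibration. The let-bound tower (n, J, loc, chart, nrm, tower) is
textually identical across items, so the chain type-checks by ζ-reduction; the route file needs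
nothing beyond Mathlib and the Statement's module (no Literature module carrying an unproved fact
enters the cone).

Rationale: WHY THIS LINE. Mechanism. Over a hypersurface germ R = S/(f), S regular, the syzygies of the residue
field beyond the Koszul range are the Koszul matrix factorisation of f built from a division f = Σ
xᵢgᵢ (Tate; Eisenbud1980): the cofactors gᵢ are the characteristic-free shadow of Euler's identity f
= Σ wᵢxᵢ∂ᵢf/d and are defined exactly where derivatives die — for z^p = F(x) one has g_z = z^(p−1)
and F = Σ xᵢFᵢ is DIVIDED, not differentiated, so p-th powers inside F are seen; the ambiguity (gᵢ
up to Koszul syzygies, z ↦ z + h) is absorbed by module isomorphism, so no coordinate, no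
hypersurface of contact and no cleaning enters (C1, C2). Flattening that module is forced progress:
by Auslander–Buchsbaum–Serre and Dutta1989 the syzygy of a singular point is torsion-free, non-free
and without free summand, so N is never principal and Φ moves every singular scheme — unlike the
Nash blow-up (Ω¹ = the first diagonal syzygy: trivial on x^p = y^q, looping on toric fourfolds in
every characteristic, CastilloEtAl2024, DuarteNunezbetancourt2020) and unlike Frobenius flattening
(Yasuda2012; the F-blow-ups of the non-F-regular double points D₄⁰, E₈⁰ are singular or non-normal,
HaraSawadaYasuda2011). Engine and evidence. In dimension two the step is McKay without a group: for
a reflexive M over a rational surface point the normalised flattening contracts exactly the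
exceptional curves E of the minimal resolution with c₁(M̃)·E = 0 (full sheaves: ArtinVerdier1985,
Esnault1985, Wunram1988), so every step extracts the curves dual to the summands of Ω²(k) and the
dual graph strictly shrinks; by hand, for EVERY surface germ of embedding dimension 3, f = xg₁ + yg₂
+ zg₃, the 2×2 minors of Ω²(k) = ⟨(y,−x,0),(z,0,−x),(0,z,−y),(g₁,g₂,g₃)⟩ are xz, yz, z², zgᵢ, so
N(Ω²(k)) = z·𝔪 and the step IS Zariski's normalised point blow-up, which resolves excellent surfaces
(Lipman1978): the surface case is calibration, not conjecture. From dimension three on the cofactors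
bite: for f = Σ_(i≤4) xᵢgᵢ the 4×4 minors of Ω³(k) ⊂ ∧² ⊕ R·T contain x₄³𝔪 but also x₄²gᵢgⱼ and
x₄g₄·xᵢgᵢgⱼ (computed this session from Tate's resolution), so the centre is the closed point
thickened towards the divided data (xᵢFᵢ, FᵢFⱼ) of F — a characteristic-free substitute for the
Jacobian/Tjurina ideal that neither a point blow-up nor the reduced singular locus sees; and at
non-isolated stages the centre is the whole singular locus with its module-determined structure plus
normalisation, i.e. the LARGEST centre, which is how Hauser–Perlega's point-centred cycles are
escaped in print (HauserPerlega2019 §3). Imported area: homological algebra of maximal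
Cohen–Macaulay modules (matrix factorisations, MCM approximations AuslanderBuchweitz1989, geometric
McKay) used as a BLOW-UP RULE, and flattening of modules (Raynaud–Gruson, Villamayor2006Flattening).
What no listed route does: flatten a MODULE. Route HomologicalConductor (this seat, g5) blows up the
annihilator ideal ca of all high Ext and measures a conductor value; here the datum is the universal
test module itself, the mechanism is curve extraction by first Chern classes of full sheaves, and
the decomposition is by valuation rank (rank one / higher rank / globalisation), not Persistence /
StrictDrop / NoZeno; the two towers already differ on Aₙ (ca = (x, y, z^⌈n/2⌉) bisects the chain; N
= z𝔪 peels its two ends).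

RANKED CRUXES. #2 RankOneTermination (crux) — for every prime p, field k of char p, finitely
generated field K/k, valuation ring O ⊇ k of K of RANK ONE and DIMENSION ZERO (ringKrullDim O = 1;
residue field algebraic over k) and finitely generated A ⊆ O with Frac A = K, the syzygy-flattening
tower T₀ = A_c, T_(m+1) = (nrm T_m[N_m/x])_c reaches a regular local ring at some finite m.
(Quantified over all fields k, so by k ↦ k(t₁,…,t_s) ⊂ O_v it covers rank-one valuations of every
dimension.) [difficulty: open-problem] (why it might fail: the flattening tower may cycle along a
non-discrete rank-one (defect / kangaroo) valuation, as the normalised Nash tower cycles on toric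
fourfolds in every characteristic (CastilloEtAl2024) and point centres pump residual orders
(HauserPerlega2019); N(Ω⁴) on those cones is uncomputed.) [CastilloEtAl2024, HauserPerlega2019,
CutkoskyMourtada2019, ArtinVerdier1985, Dutta1989]
#3 HigherRankTermination (crux) — given RankOneTermination over all ground fields of characteristic
p, the tower reaches a regular local ring along every DIMENSION-ZERO valuation of K/k (any rank):
once the centre of the rank-one coarsening v₁ has become regular (R1 over k(t) ⊂ O_(v₁)), the closed
centre is modified through the syzygies of the NON-ISOLATED singular locus it lies on, steered by
the residual valuation, until regular. [deps: RankOneTermination] [difficulty: L] (why it might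
fail: at a closed centre on the closure of a regularised positive-dimensional centre the operator
flattens Ω^n(O_Sing) of a non-isolated locus; transversal cycling there (product-type strata —
CastilloEtAl2024's cones are non-isolated) is not excluded by rank-one termination.)
[NovacoskiSpivakovsky2016, CastilloEtAl2024, Spivakovsky1990, ZariskiSamuel1960]
#4 Globalisation (crux) — for every prime p: termination of the tower along every DIMENSION-ZERO
valuation trivial on k (any rank), for all fields k of char p and all finitely generated K/k, A ⊆ O
(the conclusion of HigherRankTermination, verbatim) ⇒ ResolutionInChar p. Content: (i)
dimension-zero valuations suffice (compose v with a dimension-zero valuation of its residue field;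
the tower along v is the localisation of the tower along the composite); (ii) Φ(X) = normalised
blow-up of N(Ω^n(O_Sing X)) is a Zariski-local operator on reduced separated finite-type X
(non-regular locus, syzygy sheaves up to free summands, determinant ideal up to invertible twist,
normalisation all localise), so the v-towers are the local rings at the centres of v on ONE tower of
projective birational X_m → X, isomorphisms over Reg X_(m−1); Reg X_m open (excellence) +
Riemann–Zariski quasi-compactness ⇒ one m with X_m regular; reduced ⇒ integral components, glued by
the tree's ComponentGluing. [difficulty: M] (why it might fail: N must patch to ONE determinant
ideal sheaf up to invertible twist, its stalk at a non-closed centre must be the pointed module up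
to free summands, and Φ must commute with localising at a coarser centre; else the v-towers are not
charts of one X-scheme and RZ-compactness has nothing to act on.) [NovacoskiSpivakovsky2016,
ZariskiSamuel1960, Villamayor2006Flattening, OnetoZatini1991, Temkin2008]
#9 DimZeroSuffices (support) — (free reduction, also used inside Globalisation) termination along
all dimension-zero valuations ⇒ termination along all valuations: compose v with a dimension-zero
valuation w of its residue field over k; the centre of v∘w specialises the centre of v on every X_m,
the tower along v is the localisation of the tower along v∘w, and a localisation of a regular local
ring is regular. [difficulty: provable-now] [ZariskiSamuel1960, NovacoskiSpivakovsky2016]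
#9 NoStall (support) — the tower never idles: T_(m+1) = T_m (as subrings of K) forces T_m regular —
otherwise J ≠ T, pd(T/J) = ∞ already at the generic points of V(J) (Auslander–Buchsbaum–Serre), so M
= Ω^n(T/J) is torsion-free and non-free (no free summand, Dutta1989), Cramer's rule makes N(M)
non-principal, and some g/x lies outside T_m. [difficulty: provable-now] [Dutta1989,
AuslanderBuchweitz1989, Eisenbud1980]
#9 SurfaceTermination (support) — dominated special case and calibration: for A of Krull dimension 2
the tower terminates along every valuation — at every point of embedding dimension 3 the step is the
normalised point blow-up (N(Ω²(k)) = z𝔪, computed), i.e. Zariski–Lipman (Lipman1978); at rational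
points of any embedding dimension each step extracts the exceptional curves dual to the summands of
Ω²(k) (ArtinVerdier1985, Esnault1985, Wunram1988); open where both fail (non-rational points of
embedding dimension ≥ 4, and full-sheaf theory over imperfect residue fields). [difficulty: L]
[Lipman1978, ArtinVerdier1985, Wunram1988, Esnault1985, HaraSawadaYasuda2011]

TWO-LAYER PLAN. Foreseen glued splits (not filed now): RankOneTermination ⇐ IsolatedStages (along v,
stages whose centre is an isolated singular point: the pointed flattening of Ω^n(κ) — the
Koszul-cofactor centre) → StratumStages (non-isolated stages: flattening Ω^n(O_Sing) =
largest-centre move + normalisation) → RankOneTermination; Globalisation ⇐ DeterminantSheaf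
(N(Ω^n(O_Sing)) is an ideal sheaf up to invertible twist and localises to the pointed ideal up to
principal scaling) → TowerCompactness (one projective tower + RZ quasi-compactness ⇒ HasResolution)
→ Globalisation; HigherRankTermination ⇐ TransversalProduct (the operator commutes with
generically-trivial families along a regularised stratum) → ResidualSteering →
HigherRankTermination.

KILL CRITERIA. A computed chart of one normalised N-blow-up isomorphic to its input at the centre of
a valuation (a LOOP of Φ along v — first candidates: CastilloEtAl2024's toric fourfold cones,
Cossart–Piltant's Z^p + u₄u₁^p + u₃u₂^p, Hauser–Perlega's z^(p³) + F family followed along their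
runs) refutes RankOneTermination and closes the route `refuted:RankOneTermination` — and is worth
having: the first forced periodic tower of a canonical flattening (negative knowledge for
HomologicalConductor, ShadowGame, FrobeniusClosing and the kunz-frobenius card). Transversal cycling
at a non-isolated stage with rank-one termination intact refutes HigherRankTermination only: pivot
to the pointed variant (flatten Ω^n(κ(c)) at closed singular points c of the worst stratum) as a NEW
item. Non-sheafiness of N refutes Globalisation as stated: restate with the sheafified determinant.
Resolution of excellent surfaces failing for the tower (¬SurfaceTermination at a non-rational point)
does not close the route but removes its calibration and should lower its tier. The summit proved by
any route moots it; LU + patching elsewhere does not (different, canonical object).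

NOT DECOMPOSED YET. The isolated / non-isolated stage split of RankOneTermination; the
determinant-sheaf lemma inside Globalisation; the toric case (Φ is torus-equivariant on toric X, so
termination there is a statement about iterated polyhedral subdivisions — the natural layer-2 child
and the cheapest refutation arena); the wild core T = S[z]/(z^p + F) as a dominated special case;
imperfect residue fields need nothing extra (syzygies and Auslander–Buchsbaum–Serre are absolute)
and are deliberately not split off; the index (n = dim; the MF partner Ω^(n+1) gives x·𝔪 on surface
germs as well) is fixed, not optimised.

CHEAPEST FALSIFIER. (a) Macaulay2/Singular-sized, NOT run (no CAS on the hub or the kit lanes;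
logged for the refuter): res(coker of O_Sing) over the CastilloEtAl2024 toric fourfold semigroup
rings and over k[x,y,w,z]/(z^p+F) for CP's and HP's F; n-th syzygy, an embedding into R^r, the r×r
minors N, `normalToricRing`/`normal` of the Rees algebra chart at the valuation's centre; a chart
isomorphic to the input kills RankOneTermination. (b) By hand, DONE: embedding-dimension-3 surface
germs give N(Ω²(k)) = z𝔪 and N(Ω³(k)) = x𝔪 (step = normalised point blow-up: Aₙ peels both ends, D₄⁰
and E₈⁰ in char 2 go to 3A₁ resp. an E₇-type point — consistent with McKay and with Lipman1978, no
kill); regular T ⇒ J = T ⇒ N = (1) ⇒ tower stationary (no junk progress); dimension one ⇒ T₁ =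
normalisation = regular. (c) Lookup, PARTIAL: zbMATH 'Nash blowup' (25 rows: higher Nash, F-, toric,
determinantal — no syzygy/MCM flattening), arXiv 'special Cohen–Macaulay rational surface' (2: IKWY
arXiv:1209.4215, IW arXiv:1606.09445 — reconstruction algebra, char 0, no blow-up rule);
ArtinVerdier1985 paywalled (acq-06463); OpenAlex/S2 rate-limited all session.

NUMBERS. Betti numbers of k over a hypersurface of embedding dimension e: (1+t)^e/(1−t²) — for
surfaces b = 1,3,4,4,…, rank Ω² = 2, μ = 4; for threefolds b = 1,4,7,8,8,…, rank Ω³ = 4, μ = 8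
(Tate; Eisenbud1980 periodicity). Surface germs of embedding dimension 3: N(Ω²(k)) = z𝔪 (6 minors:
xz, yz, z², zg₁, zg₂, xg₁+yg₂ = −zg₃). Aₙ: ⌈n/2⌉ steps; Dₙ, E₆, E₇, E₈: one curve per step (≤ number
of vertices). Normalised Nash towers loop in every dimension ≥ 4 and every characteristic
(CastilloEtAl2024); F-blow-ups of D₄⁰, E₆⁰, E₇⁰, E₈⁰ (p = 2, 3, 5) are not the minimal resolution
(HaraSawadaYasuda2011). Items at open: 7 (3 cruxes, 3 supports, 1 assembly).

DEFINITION REQUESTS. After open: `ledger workitem add --kind definition --notion ModuleBlowup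
--topic Literature/AlgebraicGeometry/Resolution` (the Nash transform / universal flattening of a
coherent sheaf M of generic rank r on an integral scheme = blow-up of the fractional ideal ∧^r
M/torsion; OnetoZatini1991, Villamayor2006Flattening Thm. on flattening by blowing up; Yasuda2012 §2
for the F_*O instance) and `--notion SyzygySheaf` (n-th syzygy sheaf of a coherent module w.r.t. a
locally free resolution, well defined up to locally free summands — Schanuel) — the route file
inlines both as a `let` over LinearMap.range / Matrix.det, so no definition blocks the open; the
notions let provers replace the inline chart by the named blow-up. Cite facts wanted: Dutta1989
('fact: a local ring some syzygy of whose residue field has a free summand is regular'),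
ArtinVerdier1985 Thm. 1.11 ('fact: full sheaves of indecomposable reflexive modules over a rational
double point have c₁ dual to the exceptional curves'), Lipman1978 ('fact: normalised point blow-ups
resolve excellent surfaces').

Novelty: Searches (2026-08-16): `lit search --source zbmath "Nash blowup"` (25: higher Nash arXiv:1411.2676,
Nash in char p arXiv:2001.10491, toric arXiv:2208.05599 / arXiv:2002.07081, determinantal
arXiv:2409.04688, Mather–Yau for Nash algebras arXiv:2412.07254 — all flatten DIFFERENTIAL modules);
`lit search --source arxiv "special Cohen-Macaulay modules rational surface singularities"` (2:
arXiv:1209.4215, arXiv:1606.09445 — reconstruction algebras, char 0, read §3: no blow-up rule); `lit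
search --source zbmath "Artin Verdier reflexive modules rational double points"` (4:
ArtinVerdier1985, Gonzalez-Sprinberg–Verdier 1987, Wunram1988, Auslander 1986 survey); `lit search
--source zbmath "flattening of coherent sheaves"` (10: Villamayor2006Flattening, Rydh
arXiv:1408.6698, Ducros arXiv:1906.00301); `lit search --source arxiv` for 'Nash blowup module
maximal Cohen-Macaulay', 'Nash blowup reflexive module' (0, 0); `lit galaxy search "reflexive
modules over rational double points" --star all` (2, unrelated), `"full sheaf" --star all` (19,
noise); ledger: 22 route headers read, 185 cards (digest in folder), `ledger negatives` (0);
OpenAlex / Semantic Scholar HTTP 429 all session and the local page index reset (stated limitation);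
ArtinVerdier1985 paywalled, acq-06463 filed.
Nearest prior art found: module blow-ups as such — Nash (Ω¹), higher Nash (principal parts,
arXiv:1411.2676), F-blow-ups = flattening of F_*O (Yasuda2012, HaraSawadaYasuda2011), flattening by
blowing up (Villamayor2006  [refs: 1411.2676, 2001.10491, 2208.05599, 2002.07081, 2409.04688, 2412.07254, 1209.4215, 1606.09445, 1408.6698, 1906.00301, ArtinVerdier1985, Wunram1988, Yasuda2012, HaraSawadaYasuda2011, OnetoZatini1991, CastilloEtAl2024]

Barriers (technique_class: syzygy-flattening matrix-factorization module-blowup): - technique_class: syzygy-flattening matrix-factorization module-blowup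
- Literature.Barriers.ResolutionOfSingularities.Hauser2003_kangarooShadeIncrease: evaded by object —
no order, shade, residual order or coefficient ideal is tracked and no hypersurface is chosen; the
datum is a module up to isomorphism, on which the coordinate change x ↦ x + yz³ that creates the
kangaroo does not act; Kollár's 'no replacement for higher derivatives' (3.74.6) is answered by
division (Koszul cofactors), not by Hasse derivatives (C1).
- Literature.Barriers.ResolutionOfSingularities.hauserPerlega_mohProofBoundFails: not evaded in
substance — an unbounded residual order could reappear as a loop of Φ along a defect valuation (crux
RankOneTermination); the bet is that the tower never makes HP's move at their stages: where a larger
permissible centre exists the singular locus is positive-dimensional and Φ flattens Ω^n(O_Sing) of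
the WHOLE locus and normalises (HP §3: 'one could choose at various instances a larger center than a
point').
- Literature.Barriers.ResolutionOfSingularities.Narasimhan1983_noSmoothHypersurfaceThroughTopLocus:
evaded — centres are V(N) ⊇ the singular locus with a module-determined, generally non-reduced
structure; no smooth hypersurface containing the top locus is ever required (C2); Narasimhan's
monomial curve is simply part of the centre.
- Literature.Barriers.ResolutionOfSingularities.hironakaQuadric_directrixZero_and_nearPoint: evaded
by object — no directrix/ridge co

History (route lifecycle, newest last):
- 2026-08-16T22:22:40Z · rev 1: restated Globalisation (stmt-ResolutionOfSingularities-17046) — rev 1 (draft repair, crux-only deciding theorem): Globalisation now takes DIMENSION-ZERO valuative termination (= HigherRankTermination's conclusion verbatim) a (planner-plan-novel-ResolutionOfSingularities-Re-dc19aa3a-c-v)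
- 2026-08-16T22:23:48Z · rev 2: restated Assembly (stmt-ResolutionOfSingularities-17050) — rev 2: Assembly chain and thesis/rationale text aligned with the rev-1 crux-only deciding theorem (R1 → HR → G); no statement of a crux changed (planner-plan-novel-ResolutionOfSingularities-Re-dc19aa3a-c-v)
- 2026-08-26T09:02:42Z · DORMANT — reconciler: no traction for 8.4 d (last activity item-evidence-added at 2026-08-17T22:44:56Z); parked, not closed — `ledger route dormant route-ResolutionOfSing (operator:999:2760851)

sub-problem: ResolutionOfSingularities · status: dormant · opened planner-plan-novel-ResolutionOfSingularities-Re-dc19aa3a-c-v2-g9-0 2026-08-16T22:20:29Z · rev 3 · ledger route-ResolutionOfSingularities-SyzygyFlattening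
GENERATED by the gate from the ledger (D-0016/17). Provers cite these decls: `theorem foo : Summit.ResolutionOfSingularities.ResolutionOfSingularities.Theses.SyzygyFlattening.<Decl> := …` in Summits/ResolutionOfSingularities/ResolutionOfSingularities/Theorems/<Name>.lean.
-/

namespace Summit.ResolutionOfSingularities.ResolutionOfSingularities.Theses.SyzygyFlattening

open scoped BigOperators Topology Manifold Classical MeasureTheory ProbabilityTheory Matrix InnerProductSpace ComplexConjugate ContinuousMap
open Filter Set Function TopologicalSpace MeasureTheory

attribute [summit_statement] _root_.ResolutionOfSingularities

/-- item stmt-ResolutionOfSingularities-17044 · crux · rank 2 · open · by planner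
why it might fail: the flattening tower may cycle along a non-discrete rank-one (defect / kangaroo) valuation, as the normalised Nash tower cycles on toric fourfolds in every characteristic (CastilloEtAl2024) and point centres pump residual orders (HauserPerlega2019); N(Ω⁴) on those cones is uncomputed.
sources: CastilloEtAl2024, HauserPerlega2019, CutkoskyMourtada2019, ArtinVerdier1985, Dutta1989
[crux] for every prime p, field k of char p, finitely generated field K/k, valuation ring O ⊇ k of K
of RANK ONE and DIMENSION ZERO (ringKrullDim O = 1; residue field algebraic over k) and finitely
generated A ⊆ O with Frac A = K, the syzygy-flattening tower T₀ = A_c, T_(m+1) = (nrm T_m[N_m/x])_c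
reaches a regular local ring at some finite m. (Quantified over all fields k, so by k ↦ k(t₁,…,t_s)
⊂ O_v it covers rank-one valuations of every dimension.) [difficulty: open-problem] -/
@[route_item "route-ResolutionOfSingularities-SyzygyFlattening", crux]
def RankOneTermination : Prop :=
  ∀ p : ℕ, p.Prime → ∀ (k K : Type) [Field k] [CharP k p] [Field K] [Algebra k K] (O : ValuationSubring K) (A : Subalgebra k K), (∀ c : k, algebraMap k K c ∈ O) → A.FG → IsFractionRing ↥A K → A.toSubring ≤ O.toSubring → (∀ y : K, y ∈ O → ∃ f : Polynomial k, f ≠ 0 ∧ O.valuation (Polynomial.aeval y f) < 1) → ringKrullDim ↥O = 1 → let n : ℕ := Cardinal.toNat (Algebra.trdeg k K); let J : (B : Subalgebra k K) → Ideal ↥B := fun B => sInf ((fun 𝔭 : PrimeSpectrum ↥B => 𝔭.asIdeal) '' {𝔭 : PrimeSpectrum ↥B | ¬ IsRegularLocalRing (Localization.AtPrime 𝔭.asIdeal)}); let loc : Subalgebra k K → Subalgebra k K := fun B => Algebra.adjoin k {y : K | ∃ a ∈ B, ∃ s ∈ B, s⁻¹ ∈ O ∧ y = a * s⁻¹}; let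 chart : Subalgebra k K → Subalgebra k K := fun B => Algebra.adjoin k ((B : Set K) ∪ {y : K | ∃ (b : ℕ → ℕ) (d : (i : ℕ) → ((Fin (b (i + 1)) → ↥B) →ₗ[↥B] (Fin (b i) → ↥B))) (ε : (Fin (b 0) → ↥B) →ₗ[↥B] (↥B ⧸ J B)) (r : ℕ) (ι : ↥(LinearMap.range (d (n - 1))) →ₗ[↥B] (Fin r → ↥B)), Function.Surjective ε ∧ Function.Exact (d 0) ε ∧ (∀ i : ℕ, Function.Exact (d (i + 1)) (d i)) ∧ Function.Injective ι ∧ (∀ z : Fin r → ↥B, ∃ a : ↥B, a ≠ 0 ∧ a • z ∈ LinearMap.range ι) ∧ ∃ g x : Fin r → ↥(LinearMap.range (d (n - 1))), Matrix.det (Matrix.of fun i j => ((ι (x i) j : ↥B) : K)) ≠ 0 ∧ (∀ g' : Fin r → ↥(LinearMap.range (d (n - 1))), Matrix.det (Matrix.of fun i j => ((ι (g' i) j : ↥B) : K)) * (Matrix.det (Matrix.of fun i j => ((ι (x i) j : ↥B) : K)))⁻¹ ∈ O) ∧ y = Matrix.det (Matrix.of fun i j => ((ι (g i) j : ↥B)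 : K)) * (Matrix.det (Matrix.of fun i j => ((ι (x i) j : ↥B) : K)))⁻¹}); let nrm : Subalgebra k K → Subalgebra k K := fun B => Algebra.adjoin k {y : K | IsIntegral ↥B y}; let tower : Subalgebra k K → ℕ → Subalgebra k K := fun A m => @Nat.rec (fun _ => Subalgebra k K) (loc A) (fun _ B => loc (nrm (chart B))) m; ∃ m : ℕ, IsRegularLocalRing ↥(tower A m)

/-- item stmt-ResolutionOfSingularities-17045 · crux · rank 3 · open · by planner
why it might fail: at a closed centre on the closure of a regularised positive-dimensional centre the operator flattens Ω^n(O_Sing) of a non-isolated locus; transversal cycling there (product-type strata — CastilloEtAl2024's cones are non-isolated) is not excluded by rank-one termination.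
sources: NovacoskiSpivakovsky2016, CastilloEtAl2024, Spivakovsky1990, ZariskiSamuel1960
[crux] given RankOneTermination over all ground fields of characteristic p, the tower reaches a
regular local ring along every DIMENSION-ZERO valuation of K/k (any rank): once the centre of the
rank-one coarsening v₁ has become regular (R1 over k(t) ⊂ O_(v₁)), the closed centre is modified
through the syzygies of the NON-ISOLATED singular locus it lies on, steered by the residual
valuation, until regular. [deps: RankOneTermination] [difficulty: L] -/
@[route_item "route-ResolutionOfSingularities-SyzygyFlattening", crux]
def HigherRankTermination : Prop :=
  ∀ p : ℕ, p.Prime → (∀ (k K : Type) [Field k] [CharP k p] [Field K] [Algebra k K] (O : ValuationSubring K) (A : Subalgebra k K), (∀ c : k, algebraMap k K c ∈ O) → A.FG → IsFractionRing ↥A K → A.toSubring ≤ O.toSubring → (∀ y : K, y ∈ O → ∃ f : Polynomial k, f ≠ 0 ∧ O.valuation (Polynomial.aeval y f) < 1) → ringKrullDim ↥O = 1 → let n : ℕ := Cardinal.toNat (Algebra.trdeg k K); let J : (B : Subalgebra k K) → Ideal ↥B := fun B => sInf ((fun 𝔭 : PrimeSpectrum ↥B => 𝔭.asIdeal) ''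 {𝔭 : PrimeSpectrum ↥B | ¬ IsRegularLocalRing (Localization.AtPrime 𝔭.asIdeal)}); let loc : Subalgebra k K → Subalgebra k K := fun B => Algebra.adjoin k {y : K | ∃ a ∈ B, ∃ s ∈ B, s⁻¹ ∈ O ∧ y = a * s⁻¹}; let chart : Subalgebra k K → Subalgebra k K := fun B => Algebra.adjoin k ((B : Set K) ∪ {y : K | ∃ (b : ℕ → ℕ) (d : (i : ℕ) → ((Fin (b (i + 1)) → ↥B) →ₗ[↥B] (Fin (b i) → ↥B))) (ε : (Fin (b 0) → ↥B) →ₗ[↥B] (↥B ⧸ J B)) (r : ℕ) (ι : ↥(LinearMap.range (d (n - 1))) →ₗ[↥B] (Fin r → ↥B)), Function.Surjective ε ∧ Function.Exact (d 0) ε ∧ (∀ i : ℕ, Function.Exact (d (i + 1)) (d i)) ∧ Function.Injective ι ∧ (∀ z : Fin r → ↥B, ∃ a : ↥B, a ≠ 0 ∧ a • z ∈ LinearMap.range ι) ∧ ∃ g x : Fin r → ↥(LinearMap.range (d (n - 1))), Matrix.det (Matrix.of fun i j => ((ι (x i) j : ↥B) : K)) ≠ 0 ∧ (∀ g' : Fin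 r → ↥(LinearMap.range (d (n - 1))), Matrix.det (Matrix.of fun i j => ((ι (g' i) j : ↥B) : K)) * (Matrix.det (Matrix.of fun i j => ((ι (x i) j : ↥B) : K)))⁻¹ ∈ O) ∧ y = Matrix.det (Matrix.of fun i j => ((ι (g i) j : ↥B) : K)) * (Matrix.det (Matrix.of fun i j => ((ι (x i) j : ↥B) : K)))⁻¹}); let nrm : Subalgebra k K → Subalgebra k K := fun B => Algebra.adjoin k {y : K | IsIntegral ↥B y}; let tower : Subalgebra k K → ℕ → Subalgebra k K := fun A m => @Nat.rec (fun _ => Subalgebra k K) (loc A) (fun _ B => loc (nrm (chart B))) m; ∃ m : ℕ, IsRegularLocalRing ↥(tower A m)) → ∀ (k K : Type) [Field k] [CharP k p] [Field K] [Algebra k K] (O : ValuationSubring K) (A : Subalgebra k K), (∀ c : k, algebraMap k K c ∈ O) → A.FG → IsFractionRing ↥A K → A.toSubring ≤ O.toSubring → (∀ y : K, y ∈ O → ∃ f : Polynomial k, f ≠ 0 ∧ O.valuation (Polynomial.aeval y f) < 1) → let n : ℕ := Cardinal.toNat (Algebra.trdeg k K); let J : (B : Subalgebra k K) → Ideal ↥B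 := fun B => sInf ((fun 𝔭 : PrimeSpectrum ↥B => 𝔭.asIdeal) '' {𝔭 : PrimeSpectrum ↥B | ¬ IsRegularLocalRing (Localization.AtPrime 𝔭.asIdeal)}); let loc : Subalgebra k K → Subalgebra k K := fun B => Algebra.adjoin k {y : K | ∃ a ∈ B, ∃ s ∈ B, s⁻¹ ∈ O ∧ y = a * s⁻¹}; let chart : Subalgebra k K → Subalgebra k K := fun B => Algebra.adjoin k ((B : Set K) ∪ {y : K | ∃ (b : ℕ → ℕ) (d : (i : ℕ) → ((Fin (b (i + 1)) → ↥B) →ₗ[↥B] (Fin (b i) → ↥B))) (ε : (Fin (b 0) → ↥B) →ₗ[↥B] (↥B ⧸ J B)) (r : ℕ) (ι : ↥(LinearMap.range (d (n - 1))) →ₗ[↥B] (Fin r → ↥B)), Function.Surjective ε ∧ Function.Exact (d 0) ε ∧ (∀ i : ℕ, Function.Exact (d (i + 1)) (d i)) ∧ Function.Injective ι ∧ (∀ z : Fin r → ↥B, ∃ a : ↥B, a ≠ 0 ∧ a • z ∈ LinearMap.range ι) ∧ ∃ g x : Fin r → ↥(LinearMap.range (d (n - 1))), Matrix.det (Matrix.of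 fun i j => ((ι (x i) j : ↥B) : K)) ≠ 0 ∧ (∀ g' : Fin r → ↥(LinearMap.range (d (n - 1))), Matrix.det (Matrix.of fun i j => ((ι (g' i) j : ↥B) : K)) * (Matrix.det (Matrix.of fun i j => ((ι (x i) j : ↥B) : K)))⁻¹ ∈ O) ∧ y = Matrix.det (Matrix.of fun i j => ((ι (g i) j : ↥B) : K)) * (Matrix.det (Matrix.of fun i j => ((ι (x i) j : ↥B) : K)))⁻¹}); let nrm : Subalgebra k K → Subalgebra k K := fun B => Algebra.adjoin k {y : K | IsIntegral ↥B y}; let tower : Subalgebra k K → ℕ → Subalgebra k K := fun A m => @Nat.rec (fun _ => Subalgebra k K) (loc A) (fun _ B => loc (nrm (chart B))) m; ∃ m : ℕ, IsRegularLocalRing ↥(tower A m)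

-- earlier Globalisation (stmt-ResolutionOfSingularities-17046, replaced 2026-08-16T22:22:40Z -> stmt-ResolutionOfSingularities-17061): retired by None — ∀ p : ℕ, p.Prime → (∀ (k K : Type) [Field k] [CharP k p] [Field K] [Algebra k K] (O : ValuationSubring K) (A : Subalgebra k K), (∀ c : k, algebraMap k K c ∈ O) → A.FG → IsFractionRing ↥A K → A.toSubring ≤ O.toSubring → let n : ℕ := Cardinal.toNat (A
/-- item stmt-ResolutionOfSingularities-17061 · crux · rank 4 · open · by planner
why it might fail: N must patch to ONE determinant ideal sheaf up to invertible twist, its stalk at a non-closed centre must be the pointed module up to free summands, and Φ must commute with localising at a coarser centre; else the v-towers are not charts of one X-scheme and RZ-compactness has nothing to act on.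
sources: NovacoskiSpivakovsky2016, ZariskiSamuel1960, Villamayor2006Flattening, OnetoZatini1991, Temkin2008
[crux] for every prime p: termination of the syzygy-flattening tower along every DIMENSION-ZERO
valuation trivial on k (residue field algebraic over k; any rank), for all fields k of char p, all
finitely generated K/k and A ⊆ O (the conclusion of HigherRankTermination, verbatim) ⇒
ResolutionInChar p. Content: (i) dimension-zero valuations suffice — compose v with a dimension-zero
valuation of its residue field; the tower along v is the localisation of the tower along the
composite (support DimZeroSuffices, outside the chain); (ii) Φ(X) = normalised blow-up of
N(Ω^n(O_Sing X)) is a Zariski-local operator on reduced separated finite-type X (non-regular locus,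
syzygy sheaves up to free summands, determinant ideal up to invertible twist, normalisation all
localise), so the v-towers are the local rings at the centres of v on ONE tower of projective
birational X_m → X, isomorphisms over Reg X_(m−1); Reg X_m open (excellence) + Riemann–Zariski
quasi-compactness ⇒ one m with X_m regular; reduced ⇒ integral components (tree ComponentGluing).
Rev 1: hypothesis re-cut from 'all valuations' to 'dimension-zero valuations' so that the deciding
theorem is crux-only (the free reduction DimZeroSuff -/
@[route_item "route-ResolutionOfSingularities-SyzygyFlattening", crux]
def Globalisation : Prop :=
  ∀ p : ℕ, p.Prime → (∀ (k K : Type) [Field k] [CharP k p] [Field K] [Algebra k K] (O : ValuationSubring K) (A : Subalgebra k K), (∀ c : k, algebraMap k K c ∈ O) → A.FG → IsFractionRing ↥A K → A.toSubring ≤ O.toSubring → (∀ y : K, y ∈ O → ∃ f : Polynomial k, f ≠ 0 ∧ O.valuation (Polynomial.aeval y f) < 1) → let n : ℕ := Cardinal.toNat (Algebra.trdeg k K); let J : (B : Subalgebra k K) → Ideal ↥B := fun B => sInf ((fun 𝔭 : PrimeSpectrum ↥B => 𝔭.asIdeal) '' {𝔭 : PrimeSpectrum ↥B | ¬ IsRegularLocalRing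 (Localization.AtPrime 𝔭.asIdeal)}); let loc : Subalgebra k K → Subalgebra k K := fun B => Algebra.adjoin k {y : K | ∃ a ∈ B, ∃ s ∈ B, s⁻¹ ∈ O ∧ y = a * s⁻¹}; let chart : Subalgebra k K → Subalgebra k K := fun B => Algebra.adjoin k ((B : Set K) ∪ {y : K | ∃ (b : ℕ → ℕ) (d : (i : ℕ) → ((Fin (b (i + 1)) → ↥B) →ₗ[↥B] (Fin (b i) → ↥B))) (ε : (Fin (b 0) → ↥B) →ₗ[↥B] (↥B ⧸ J B)) (r : ℕ) (ι : ↥(LinearMap.range (d (n - 1))) →ₗ[↥B] (Fin r → ↥B)), Function.Surjective ε ∧ Function.Exact (d 0) ε ∧ (∀ i : ℕ, Function.Exact (d (i + 1)) (d i)) ∧ Function.Injective ι ∧ (∀ z : Fin r → ↥B, ∃ a : ↥B, a ≠ 0 ∧ a • z ∈ LinearMap.range ι) ∧ ∃ g x : Fin r → ↥(LinearMap.range (d (n - 1))), Matrix.det (Matrix.of fun i j => ((ι (x i) j : ↥B) : K)) ≠ 0 ∧ (∀ g' : Fin r → ↥(LinearMap.range (d (n - 1))), Matrix.det (Matrix.of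 fun i j => ((ι (g' i) j : ↥B) : K)) * (Matrix.det (Matrix.of fun i j => ((ι (x i) j : ↥B) : K)))⁻¹ ∈ O) ∧ y = Matrix.det (Matrix.of fun i j => ((ι (g i) j : ↥B) : K)) * (Matrix.det (Matrix.of fun i j => ((ι (x i) j : ↥B) : K)))⁻¹}); let nrm : Subalgebra k K → Subalgebra k K := fun B => Algebra.adjoin k {y : K | IsIntegral ↥B y}; let tower : Subalgebra k K → ℕ → Subalgebra k K := fun A m => @Nat.rec (fun _ => Subalgebra k K) (loc A) (fun _ B => loc (nrm (chart B))) m; ∃ m : ℕ, IsRegularLocalRing ↥(tower A m)) → Literature.AlgebraicGeometry.Resolution.ResolutionInChar.{0} p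

/-- item stmt-ResolutionOfSingularities-17047 · support · rank 9 · open · by planner
sources: ZariskiSamuel1960, NovacoskiSpivakovsky2016
[support] termination along all dimension-zero valuations ⇒ termination along all valuations:
compose v with a dimension-zero valuation w of its residue field over k; the centre of v∘w
specialises the centre of v on every X_m, the tower along v is the localisation of the tower along
v∘w, and a localisation of a regular local ring is regular. [difficulty: provable-now] -/
@[route_item "route-ResolutionOfSingularities-SyzygyFlattening"]
def DimZeroSuffices : Prop :=
  ∀ p : ℕ, p.Prime → (∀ (k K : Type) [Field k] [CharP k p] [Field K] [Algebra k K] (O : ValuationSubring K) (A : Subalgebra k K), (∀ c : k, algebraMap k K c ∈ O) → A.FG → IsFractionRing ↥A K → A.toSubring ≤ O.toSubring → (∀ y : K, y ∈ O → ∃ f : Polynomial k, f ≠ 0 ∧ O.valuation (Polynomial.aeval y f) < 1) → let n : ℕ := Cardinal.toNat (Algebra.trdeg k K); let J : (B : Subalgebra k K) → Ideal ↥B := fun B => sInf ((fun 𝔭 : PrimeSpectrum ↥B => 𝔭.asIdeal) '' {𝔭 : PrimeSpectrum ↥B | ¬ IsRegularLocalRing (Localization.AtPrime 𝔭.asIdeal)});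 let loc : Subalgebra k K → Subalgebra k K := fun B => Algebra.adjoin k {y : K | ∃ a ∈ B, ∃ s ∈ B, s⁻¹ ∈ O ∧ y = a * s⁻¹}; let chart : Subalgebra k K → Subalgebra k K := fun B => Algebra.adjoin k ((B : Set K) ∪ {y : K | ∃ (b : ℕ → ℕ) (d : (i : ℕ) → ((Fin (b (i + 1)) → ↥B) →ₗ[↥B] (Fin (b i) → ↥B))) (ε : (Fin (b 0) → ↥B) →ₗ[↥B] (↥B ⧸ J B)) (r : ℕ) (ι : ↥(LinearMap.range (d (n - 1))) →ₗ[↥B] (Fin r → ↥B)), Function.Surjective ε ∧ Function.Exact (d 0) ε ∧ (∀ i : ℕ, Function.Exact (d (i + 1)) (d i)) ∧ Function.Injective ι ∧ (∀ z : Fin r → ↥B, ∃ a : ↥B, a ≠ 0 ∧ a • z ∈ LinearMap.range ι) ∧ ∃ g x : Fin r → ↥(LinearMap.range (d (n - 1))), Matrix.det (Matrix.of fun i j => ((ι (x i) j : ↥B) : K)) ≠ 0 ∧ (∀ g' : Fin r → ↥(LinearMap.range (d (n - 1))), Matrix.det (Matrix.of fun i j => ((ι (g' i) j : ↥B) : K))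 * (Matrix.det (Matrix.of fun i j => ((ι (x i) j : ↥B) : K)))⁻¹ ∈ O) ∧ y = Matrix.det (Matrix.of fun i j => ((ι (g i) j : ↥B) : K)) * (Matrix.det (Matrix.of fun i j => ((ι (x i) j : ↥B) : K)))⁻¹}); let nrm : Subalgebra k K → Subalgebra k K := fun B => Algebra.adjoin k {y : K | IsIntegral ↥B y}; let tower : Subalgebra k K → ℕ → Subalgebra k K := fun A m => @Nat.rec (fun _ => Subalgebra k K) (loc A) (fun _ B => loc (nrm (chart B))) m; ∃ m : ℕ, IsRegularLocalRing ↥(tower A m)) → ∀ (k K : Type) [Field k] [CharP k p] [Field K] [Algebra k K] (O : ValuationSubring K) (A : Subalgebra k K), (∀ c : k, algebraMap k K c ∈ O) → A.FG → IsFractionRing ↥A K → A.toSubring ≤ O.toSubring → let n : ℕ := Cardinal.toNat (Algebra.trdeg k K); let J : (B : Subalgebra k K) → Ideal ↥B := fun B => sInf ((fun 𝔭 : PrimeSpectrum ↥B => 𝔭.asIdeal) '' {𝔭 : PrimeSpectrum ↥B | ¬ IsRegularLocalRing (Localization.AtPrime 𝔭.asIdeal)}); let loc : Subalgebra k K → Subalgebra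 k K := fun B => Algebra.adjoin k {y : K | ∃ a ∈ B, ∃ s ∈ B, s⁻¹ ∈ O ∧ y = a * s⁻¹}; let chart : Subalgebra k K → Subalgebra k K := fun B => Algebra.adjoin k ((B : Set K) ∪ {y : K | ∃ (b : ℕ → ℕ) (d : (i : ℕ) → ((Fin (b (i + 1)) → ↥B) →ₗ[↥B] (Fin (b i) → ↥B))) (ε : (Fin (b 0) → ↥B) →ₗ[↥B] (↥B ⧸ J B)) (r : ℕ) (ι : ↥(LinearMap.range (d (n - 1))) →ₗ[↥B] (Fin r → ↥B)), Function.Surjective ε ∧ Function.Exact (d 0) ε ∧ (∀ i : ℕ, Function.Exact (d (i + 1)) (d i)) ∧ Function.Injective ι ∧ (∀ z : Fin r → ↥B, ∃ a : ↥B, a ≠ 0 ∧ a • z ∈ LinearMap.range ι) ∧ ∃ g x : Fin r → ↥(LinearMap.range (d (n - 1))), Matrix.det (Matrix.of fun i j => ((ι (x i) j : ↥B) : K)) ≠ 0 ∧ (∀ g' : Fin r → ↥(LinearMap.range (d (n - 1))), Matrix.det (Matrix.of fun i j => ((ι (g' i) j : ↥B) : K)) * (Matrix.det (Matrix.of fun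 i j => ((ι (x i) j : ↥B) : K)))⁻¹ ∈ O) ∧ y = Matrix.det (Matrix.of fun i j => ((ι (g i) j : ↥B) : K)) * (Matrix.det (Matrix.of fun i j => ((ι (x i) j : ↥B) : K)))⁻¹}); let nrm : Subalgebra k K → Subalgebra k K := fun B => Algebra.adjoin k {y : K | IsIntegral ↥B y}; let tower : Subalgebra k K → ℕ → Subalgebra k K := fun A m => @Nat.rec (fun _ => Subalgebra k K) (loc A) (fun _ B => loc (nrm (chart B))) m; ∃ m : ℕ, IsRegularLocalRing ↥(tower A m)

/-- item stmt-ResolutionOfSingularities-17048 · support · rank 9 · open · by planner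
sources: Dutta1989, AuslanderBuchweitz1989, Eisenbud1980
[support] the tower never idles: T_(m+1) = T_m (as subrings of K) forces T_m regular — otherwise J ≠
T, pd(T/J) = ∞ already at the generic points of V(J) (Auslander–Buchsbaum–Serre), so M = Ω^n(T/J) is
torsion-free and non-free (no free summand, Dutta1989), Cramer's rule makes N(M) non-principal, and
some g/x lies outside T_m. [difficulty: provable-now] -/
@[route_item "route-ResolutionOfSingularities-SyzygyFlattening"]
def NoStall : Prop :=
  ∀ p : ℕ, p.Prime → ∀ (k K : Type) [Field k] [CharP k p] [Field K] [Algebra k K] (O : ValuationSubring K) (A : Subalgebra k K), (∀ c : k, algebraMap k K c ∈ O) → A.FG → IsFractionRing ↥A K → A.toSubring ≤ O.toSubring → let n : ℕ := Cardinal.toNat (Algebra.trdeg k K); let J : (B : Subalgebra k K) → Ideal ↥B := fun B => sInf ((fun 𝔭 : PrimeSpectrum ↥B => 𝔭.asIdeal) '' {𝔭 : PrimeSpectrum ↥B | ¬ IsRegularLocalRing (Localization.AtPrime 𝔭.asIdeal)}); let loc : Subalgebra k K → Subalgebra k K := fun B => Algebra.adjoin k {y : K | ∃ a ∈ B, ∃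 s ∈ B, s⁻¹ ∈ O ∧ y = a * s⁻¹}; let chart : Subalgebra k K → Subalgebra k K := fun B => Algebra.adjoin k ((B : Set K) ∪ {y : K | ∃ (b : ℕ → ℕ) (d : (i : ℕ) → ((Fin (b (i + 1)) → ↥B) →ₗ[↥B] (Fin (b i) → ↥B))) (ε : (Fin (b 0) → ↥B) →ₗ[↥B] (↥B ⧸ J B)) (r : ℕ) (ι : ↥(LinearMap.range (d (n - 1))) →ₗ[↥B] (Fin r → ↥B)), Function.Surjective ε ∧ Function.Exact (d 0) ε ∧ (∀ i : ℕ, Function.Exact (d (i + 1)) (d i)) ∧ Function.Injective ι ∧ (∀ z : Fin r → ↥B, ∃ a : ↥B, a ≠ 0 ∧ a • z ∈ LinearMap.range ι) ∧ ∃ g x : Fin r → ↥(LinearMap.range (d (n - 1))), Matrix.det (Matrix.of fun i j => ((ι (x i) j : ↥B) : K)) ≠ 0 ∧ (∀ g' : Fin r → ↥(LinearMap.range (d (n - 1))), Matrix.det (Matrix.of fun i j => ((ι (g' i) j : ↥B) : K)) * (Matrix.det (Matrix.of fun i j => ((ι (x i) j : ↥B) : K)))⁻¹ ∈ O) ∧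 y = Matrix.det (Matrix.of fun i j => ((ι (g i) j : ↥B) : K)) * (Matrix.det (Matrix.of fun i j => ((ι (x i) j : ↥B) : K)))⁻¹}); let nrm : Subalgebra k K → Subalgebra k K := fun B => Algebra.adjoin k {y : K | IsIntegral ↥B y}; let tower : Subalgebra k K → ℕ → Subalgebra k K := fun A m => @Nat.rec (fun _ => Subalgebra k K) (loc A) (fun _ B => loc (nrm (chart B))) m; ∀ m : ℕ, tower A (m + 1) = tower A m → IsRegularLocalRing ↥(tower A m)

/-- item stmt-ResolutionOfSingularities-17049 · support · rank 9 · open · by planner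
sources: Lipman1978, ArtinVerdier1985, Wunram1988, Esnault1985, HaraSawadaYasuda2011
[support] dominated special case and calibration: for A of Krull dimension 2 the tower terminates
along every valuation — at every point of embedding dimension 3 the step is the normalised point
blow-up (N(Ω²(k)) = z𝔪, computed), i.e. Zariski–Lipman (Lipman1978); at rational points of any
embedding dimension each step extracts the exceptional curves dual to the summands of Ω²(k)
(ArtinVerdier1985, Esnault1985, Wunram1988); open where both fail (non-rational points of embedding
dimension ≥ 4, and full-sheaf theory over imperfect residue fields). [difficulty: L] -/
@[route_item "route-ResolutionOfSingularities-SyzygyFlattening"]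
def SurfaceTermination : Prop :=
  ∀ p : ℕ, p.Prime → ∀ (k K : Type) [Field k] [CharP k p] [Field K] [Algebra k K] (O : ValuationSubring K) (A : Subalgebra k K), (∀ c : k, algebraMap k K c ∈ O) → A.FG → IsFractionRing ↥A K → A.toSubring ≤ O.toSubring → ringKrullDim ↥A = 2 → let n : ℕ := Cardinal.toNat (Algebra.trdeg k K); let J : (B : Subalgebra k K) → Ideal ↥B := fun B => sInf ((fun 𝔭 : PrimeSpectrum ↥B => 𝔭.asIdeal) '' {𝔭 : PrimeSpectrum ↥B | ¬ IsRegularLocalRing (Localization.AtPrime 𝔭.asIdeal)}); let loc : Subalgebra k K → Subalgebra k K := fun B => Algebra.adjoin k {y : K | ∃ a ∈ B, ∃ s ∈ B, s⁻¹ ∈ O ∧ y = a * s⁻¹}; let chart : Subalgebra k K → Subalgebra k K := fun B => Algebra.adjoin k ((B : Set K) ∪ {y : K | ∃ (b : ℕ → ℕ) (d : (i : ℕ) → ((Fin (b (i + 1)) → ↥B) →ₗ[↥B] (Fin (b i) → ↥B))) (ε : (Fin (b 0) → ↥B) →ₗ[↥B] (↥B ⧸ J B)) (r : ℕ) (ι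 : ↥(LinearMap.range (d (n - 1))) →ₗ[↥B] (Fin r → ↥B)), Function.Surjective ε ∧ Function.Exact (d 0) ε ∧ (∀ i : ℕ, Function.Exact (d (i + 1)) (d i)) ∧ Function.Injective ι ∧ (∀ z : Fin r → ↥B, ∃ a : ↥B, a ≠ 0 ∧ a • z ∈ LinearMap.range ι) ∧ ∃ g x : Fin r → ↥(LinearMap.range (d (n - 1))), Matrix.det (Matrix.of fun i j => ((ι (x i) j : ↥B) : K)) ≠ 0 ∧ (∀ g' : Fin r → ↥(LinearMap.range (d (n - 1))), Matrix.det (Matrix.of fun i j => ((ι (g' i) j : ↥B) : K)) * (Matrix.det (Matrix.of fun i j => ((ι (x i) j : ↥B) : K)))⁻¹ ∈ O) ∧ y = Matrix.det (Matrix.of fun i j => ((ι (g i) j : ↥B) : K)) * (Matrix.det (Matrix.of fun i j => ((ι (x i) j : ↥B) : K)))⁻¹}); let nrm : Subalgebra k K → Subalgebra k K := fun B => Algebra.adjoin k {y : K | IsIntegral ↥B y}; let tower : Subalgebra k K → ℕ → Subalgebra k K := fun A m => @Nat.rec (fun _ => Subalgebra k K) (loc A) (fun _ B => loc (nrm (chart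 B))) m; ∃ m : ℕ, IsRegularLocalRing ↥(tower A m)

-- earlier Assembly (stmt-ResolutionOfSingularities-17050, replaced 2026-08-16T22:23:48Z -> stmt-ResolutionOfSingularities-17080): retired by None — RankOneTermination → HigherRankTermination → DimZeroSuffices → Globalisation → _root_.ResolutionOfSingularities
/-- item stmt-ResolutionOfSingularities-17080 · assembly · rank 1 · open · by planner
sources: ZariskiSamuel1960, Lipman1978
[assembly] RankOneTermination → HigherRankTermination → Globalisation → ResolutionOfSingularities
(rev 1: DimZeroSuffices absorbed into Globalisation). -/
@[route_item "route-ResolutionOfSingularities-SyzygyFlattening"]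
def Assembly : Prop :=
  RankOneTermination → HigherRankTermination → Globalisation → _root_.ResolutionOfSingularities

/-! D-0027 §2.1 — DECIDING THEOREM (planner-authored via `route open/edit --closes-file`; by planner-plan-novel-ResolutionOfSingularities-Re-dc19aa3a-c-v 2026-08-16T22:22:40Z):
its hypotheses are this route's items and its conclusion the sub-problem Statement (glue_lint), and it elaborates with this file. -/

@[closes "route-ResolutionOfSingularities-SyzygyFlattening"] theorem closes (h1 : RankOneTermination) (h2 : HigherRankTermination) (hG : Globalisation) :
    _root_.ResolutionOfSingularities :=
  fun p hp => hG p hp (h2 p hp (h1 p hp))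

end Summit.ResolutionOfSingularities.ResolutionOfSingularities.Theses.SyzygyFlattening
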